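import Mathlib
import HarnessLib
import Summits.RiemannHypothesis.RiemannHypothesis.Theorems.MayerPairingBranchPairingDefs

/-!
# Crux `MayerPairing.BranchPairing` (stmt-RiemannHypothesis-1471), line `weinstein-aronszajn-pinning`:
the two halves of the Kato-selection stub

The registered stub `stub_katoSelection : KatoSelection` of the line (a continuous eigenvalue
selection inside a resolvent tube of a norm-continuous compact family over a real interval; Kato
1966, II-§5.2 Thm 5.2 with IV-§3.5) is RESHAPED by the lead into two registered stubs of honest
size, whose conjunction gives it back by the kernel-checked glue `katoSelection_of` below
(registered sub-goal of stmt-RiemannHypothesis-1471):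

* `TubeSpectrumData` (operator theory, L): along the tube, the spectral slices
  `S σ = spec (T σ) ∩ {‖μ − 1‖ < δ σ}` are non-empty for EVERY `σ` (Riesz projection over the
  moving circle is a norm-continuous idempotent, non-zero at `σ = a`, hence everywhere on the
  connected `[a, b]`), uniformly finite (eigenvectors of distinct eigenvalues are independent in the
  finite-dimensional range of the compact idempotent), have closed graph (joint openness of the
  resolvent set) and are lower semicontinuous (persistence of an eigenvalue inside a small circle,
  `Literature.Analysis.OperatorTheory.eventually_spectrum_inter_ball_nonempty_of_apply_eq_smul`,
  plus the Fredholm alternative `IsCompactOperator.hasEigenvalue_iff_mem_spectrum`);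
* `FiniteSetSelection` (point-set topology, L): a set-valued map over a compact real interval with
  non-empty, uniformly finite, bounded values, closed graph and lower semicontinuity admits a
  continuous selection through any prescribed point of its graph (Kato II-§5.2 Thm 5.2 in set form:
  induction on the cardinality bound — where a slice has ≥ 2 points the bound drops locally in
  each cluster, where it has 1 point the selection is forced and any choice on the complementary
  open intervals is continuous up to the boundary).

No objects of the route occur here: both statements are ζ-free and Mayer-free.
-/

noncomputable section

namespace Summit.RiemannHypothesis.RiemannHypothesis.Theorems.MayerPairingPinning

open Set Metric

/-- STUB 2a (L, operator theory) — **spectral slices in a resolvent tube.** For a norm-continuous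
family `σ ↦ T σ` of compact operators on a complex Banach space over `[a, b]`, a continuous radius
`0 < δ σ < 1` whose circle `‖μ − 1‖ = δ σ` never meets `spec (T σ)`, and one spectral point inside
at `σ = a`, the slices `S σ = spec (T σ) ∩ ball 1 (δ σ)` are (i) non-empty for every `σ ∈ [a, b]`,
(ii) finite of uniformly bounded cardinality, (iii) of closed graph over `[a, b]`, and (iv) lower
semicontinuous. (Kato 1966, IV-§3.4 Thm 3.16 and §3.5; registered stub `stub_tubeSpectrumData` of
stmt-RiemannHypothesis-1471.) -/
def TubeSpectrumData : Prop :=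
  ∀ (E : Type) [NormedAddCommGroup E] [NormedSpace ℂ E] [CompleteSpace E]
    (T : ℝ → (E →L[ℂ] E)) (δ : ℝ → ℝ) (a b : ℝ), a ≤ b →
    ContinuousOn T (Set.Icc a b) → ContinuousOn δ (Set.Icc a b) →
    (∀ σ ∈ Set.Icc a b, IsCompactOperator (T σ)) →
    (∀ σ ∈ Set.Icc a b, 0 < δ σ ∧ δ σ < 1) →
    (∀ σ ∈ Set.Icc a b, ∀ μ : ℂ, ‖μ - 1‖ = δ σ → μ ∉ spectrum ℂ (T σ)) →
    (∃ μ ∈ spectrum ℂ (T a), ‖μ - 1‖ < δ a) →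
    (∀ σ ∈ Set.Icc a b, (spectrum ℂ (T σ) ∩ Metric.ball 1 (δ σ)).Nonempty) ∧
    (∃ n : ℕ, ∀ σ ∈ Set.Icc a b, ∃ F : Finset ℂ,
        (↑F : Set ℂ) = spectrum ℂ (T σ) ∩ Metric.ball 1 (δ σ) ∧ F.card ≤ n) ∧
    IsClosed {p : ℝ × ℂ | p.1 ∈ Set.Icc a b ∧ p.2 ∈ spectrum ℂ (T p.1) ∩ Metric.ball 1 (δ p.1)} ∧
    (∀ σ₀ ∈ Set.Icc a b, ∀ μ₀ ∈ spectrum ℂ (T σ₀) ∩ Metric.ball 1 (δ σ₀), ∀ ε > (0 : ℝ),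
      ∃ η > (0 : ℝ), ∀ σ ∈ Set.Icc a b, |σ - σ₀| < η →
        ∃ μ ∈ spectrum ℂ (T σ) ∩ Metric.ball 1 (δ σ), ‖μ - μ₀‖ < ε)

/-- STUB 2b (L, point-set topology) — **continuous selection of a finite-set-valued map over an
interval.** Let `S : ℝ → Set ℂ` have, over `[a, b]`, non-empty values of cardinality `≤ n`,
closed graph, bounded values, and be lower semicontinuous. Then through every point `(σ₁, μ₁)` of
its graph passes a continuous selection `Λ` on `[a, b]` (`Λ σ ∈ S σ`, `Λ σ₁ = μ₁`). (Kato 1966,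
II-§5.2 Thm 5.2, set form; registered stub `stub_finiteSetSelection` of stmt-RiemannHypothesis-1471.) -/
def FiniteSetSelection : Prop :=
  ∀ (n : ℕ) (S : ℝ → Set ℂ) (a b : ℝ), a ≤ b →
    (∀ σ ∈ Set.Icc a b, (S σ).Nonempty) →
    (∀ σ ∈ Set.Icc a b, ∃ F : Finset ℂ, (↑F : Set ℂ) = S σ ∧ F.card ≤ n) →
    IsClosed {p : ℝ × ℂ | p.1 ∈ Set.Icc a b ∧ p.2 ∈ S p.1} →
    (∃ R : ℝ, ∀ σ ∈ Set.Icc a b, ∀ μ ∈ S σ, ‖μ‖ ≤ R) →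
    (∀ σ₀ ∈ Set.Icc a b, ∀ μ₀ ∈ S σ₀, ∀ ε > (0 : ℝ), ∃ η > (0 : ℝ), ∀ σ ∈ Set.Icc a b,
        |σ - σ₀| < η → ∃ μ ∈ S σ, ‖μ - μ₀‖ < ε) →
    ∀ σ₁ ∈ Set.Icc a b, ∀ μ₁ ∈ S σ₁,
      ∃ Λ : ℝ → ℂ, ContinuousOn Λ (Set.Icc a b) ∧ Λ σ₁ = μ₁ ∧ ∀ σ ∈ Set.Icc a b, Λ σ ∈ S σ

/-- **The reshaped Kato stub, glued** (registered sub-goal `katoSelection_of` of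
stmt-RiemannHypothesis-1471): `TubeSpectrumData → FiniteSetSelection → KatoSelection`. The slices
are bounded by `2` (`‖μ‖ ≤ ‖μ − 1‖ + 1 < δ σ + 1 < 2`); select through the spectral point given at
`σ = a`. [folklore] -/
theorem katoSelection_of : TubeSpectrumData → FiniteSetSelection → KatoSelection := by
  intro h1 h2 E _ _ _ T δ a b hab hT hδ hc h01 hcirc hspec
  obtain ⟨hne, ⟨n, hfin⟩, hclosed, hlsc⟩ := h1 E T δ a b hab hT hδ hc h01 hcirc hspec
  have hbdd : ∃ R : ℝ, ∀ σ ∈ Set.Icc a b, ∀ μ ∈ spectrum ℂ (T σ) ∩ Metric.ball 1 (δ σ),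
      ‖μ‖ ≤ R := by
    refine ⟨2, fun σ hσ μ hμ => ?_⟩
    have h1 : ‖μ - 1‖ < δ σ := by simpa [dist_eq_norm] using hμ.2
    have h2 : δ σ < 1 := (h01 σ hσ).2
    calc ‖μ‖ = ‖(μ - 1) + 1‖ := by ring_nf
      _ ≤ ‖μ - 1‖ + ‖(1 : ℂ)‖ := norm_add_le _ _
      _ ≤ 2 := by rw [norm_one]; linarith
  obtain ⟨μa, hμa⟩ := hne a (left_mem_Icc.2 hab)
  obtain ⟨Λ, hΛc, -, hΛ⟩ := h2 n (fun σ => spectrum ℂ (T σ) ∩ Metric.ball 1 (δ σ)) a b hab hne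
    hfin hclosed hbdd hlsc a (left_mem_Icc.2 hab) μa hμa
  refine ⟨Λ, hΛc, fun σ hσ => ?_⟩
  obtain ⟨hsp, hball⟩ := hΛ σ hσ
  exact ⟨by simpa [dist_eq_norm] using hball, hsp⟩

end Summit.RiemannHypothesis.RiemannHypothesis.Theorems.MayerPairingPinning

end
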